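import Summits.CriticalPhenomena.PercolationContinuityZ3.Theorems.PercNearOneGluingNoHeavyLowerTailKnQuestion8CoefficientwiseCoreClassPeeling
import Summits.CriticalPhenomena.PercolationContinuityZ3.Theorems.PercNearOneGluingNoHeavyLowerTailKnQuestion8CoefficientwiseCoreClassKernel
import Summits.CriticalPhenomena.PercolationContinuityZ3.Theorems.PercNearOneGluingNoHeavyLowerTailKnQuestion8CoefficientwiseParallelClosure
import HarnessLib

/-!
# THEOREM KB-DOM: the coefficientwise first rung on the core class `N(x) = N(z) = {a, b}` follows from a DOMINATION MAP of the middle graph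

Support file (`--supports stmt-CriticalPhenomena-4575`, closed), prover `prim-cplus-coupling` (gen 30).  No definitions, no notations, no named facts,
no sorries; standard axioms.  Memo `prim-cplus-coupling/A5-COUPLING-gen30.md` §1.  Companions: `…CoreClass` (THEOREM CORE₂, supermodular `f`),
`…CoreClassPeeling` (the exact peeling identities), `…CoreClassKernel`.

Setting (prim-lf-2's CORE CLASS at `|N| = 2`): a finite multigraph `ends : ι → Sym2 V` with edge set `E₀ = E_H ∪ {ixa, ixb, iza, izb}`,
`ends ixa = s(x,a)`, …, no edge of `E_H` at `x` or `z`; colourings `s ⊆ E₀`, `K = C_x(s)`, `L = C_x(E₀ ∖ s)`, wall `T = {z ∉ K} ∩ {z ∉ L}`.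
On the middle graph `H = (V, E_H)` write `R_v(ω) = C_v(ω)`, `B_v(ω) = C_v(E_H ∖ ω)` and `T_H(a,b) = {b ∉ R_a} ∩ {b ∉ B_a}` (no monochromatic `a–b` path).

DOMINATION MAP (new notion, used only as a hypothesis, never defined): a map `ψ` on the colourings of `E_H` which is injective on `T_H(a,b)`, stays
inside `2^{E_H}`, and satisfies `R_a(ω) ∪ B_b(ω) ⊆ R_a(ψ ω) ∪ R_b(ψ ω)` for every `ω ∈ T_H(a,b)` — 'the two red clusters of the terminals after `ψ`
cover the red cluster of `a` and the blue cluster of `b` before'.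

* `Coefficientwise.coreClass_kernel_nonneg_of_dom` — if `(H; a, b)` admits a domination map then the core-class kernel
  `Σ_{ω ⊆ E_H} f(R_a ∪ R_b)(g(R_a ∪ R_b) − g ∅) + Σ_{T_H(a,b)} [f(R_a)(g R_a − g B_b) + f(R_b)(g R_b − g B_a)]` is `≥ 0` for EVERY monotone `f` with
  `f ∅ = 0` and every monotone `g` (no supermodularity).  Proof: symmetrise the second sum by the colour swap (it becomes
  `Σ_{T_H} (f R_a − f B_b)(g R_a − g B_b)`), bound the Harris sum below by its restriction to the image `ψ(T_H)` (injectivity, nonnegative terms), and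
  use the pointwise inequality `f(S)(g S − g ∅) + (f P − f Q)(g P − g Q) ≥ 0` for `S ⊇ P ∪ Q` (all four values lie in `[0, f S]`, `[g ∅, g S]`).
* `Coefficientwise.cwpa_coreClass_of_dom` — hence, by the peeling identities of `…CoreClassPeeling`, **CW-PA holds on the core class over any middle
  graph with a domination map, for ALL monotone `f, g`**: `0 ≤ Σ_T f(K)(g(K) − g(L))`.
* `Coefficientwise.cwpa_coreClass_symm_of_dom` — the same in the symmetric form `0 ≤ Σ_T (f K − f L)(g K − g L)` (the shape consumed by prim-lf-2's
  `cwpa_decoration` / `cwpa_series` / `cwpa_parallel`).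
Domination maps exist for every `a–b` path and are preserved by parallel composition at `{a, b}` (memo §1: so CW-PA holds for `W₀` with the edge `ab`
replaced by any bundle of threads), and — exact census, memo §2 — for EVERY two-terminal graph on `≤ 7` vertices in which each vertex lies on an
`a–b` path (Hall's condition checked by max-flow; the only failures are graphs with a part hanging off a single vertex, which prim-lf-2's
`cwpa_decoration` removes).  CONJECTURE DOM-TAUT (memo §2) would therefore give CW-PA on the whole core class `|N| = 2`.
[cite: KozmaNitzan2024, Questions 8–9 (§5.5 p. 36) (context: the Question-8 pocket covariance programme)]
-/

namespace Summit.CriticalPhenomena.PercolationContinuityZ3.Theorems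

open Finset Literature.Probability.Percolation

namespace Coefficientwise

variable {ι V : Type*}

/-- Pointwise inequality behind THEOREM KB-DOM: if `0 ≤ α, β ≤ A` and `0 ≤ γ, δ ≤ B` then `0 ≤ A·B + (α − β)(γ − δ)`.
[cite: KozmaNitzan2024, §5.5 (context only; elementary)] -/
theorem mul_add_sub_mul_sub_nonneg {A B α β γ δ : ℝ} (hα : 0 ≤ α) (hαA : α ≤ A) (hβ : 0 ≤ β) (hβA : β ≤ A)
    (hγ : 0 ≤ γ) (hγB : γ ≤ B) (hδ : 0 ≤ δ) (hδB : δ ≤ B) : 0 ≤ A * B + (α - β) * (γ - δ) := by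
  have h1 : |α - β| ≤ A := abs_sub_le_iff.mpr ⟨by linarith, by linarith⟩
  have h2 : |γ - δ| ≤ B := abs_sub_le_iff.mpr ⟨by linarith, by linarith⟩
  have h3 : |(α - β) * (γ - δ)| ≤ A * B := by
    rw [abs_mul]
    exact mul_le_mul h1 h2 (abs_nonneg _) (le_trans (abs_nonneg _) h1)
  have h4 := neg_abs_le ((α - β) * (γ - δ))
  linarith

open Classical in
/-- **Core-class kernel from a domination map.**  For a finite multigraph (`ends`, edge set `E`), vertices `a, b`, a monotone `f : Set V → ℝ` with
`f ∅ = 0`, a monotone `g`, and a map `ψ` with `ψ ω ⊆ E`, `ψ` injective on the wall event `{b ∉ R_a(ω), b ∉ B_a(ω)}` and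
`R_a(ω) ∪ B_b(ω) ⊆ R_a(ψ ω) ∪ R_b(ψ ω)` there (`R_v(ω) = C_v(ω)`, `B_v(ω) = C_v(E ∖ ω)`):
`0 ≤ Σ_{ω ⊆ E} f(R_a ∪ R_b)(g(R_a ∪ R_b) − g ∅) + Σ_{ω ⊆ E : b ∉ R_a, b ∉ B_a} [f(R_a)(g(R_a) − g(B_b)) + f(R_b)(g(R_b) − g(B_a))]`.
[cite: KozmaNitzan2024, Questions 8–9 (§5.5 p. 36) (context)] -/
theorem coreClass_kernel_nonneg_of_dom [DecidableEq ι] (ends : ι → Sym2 V) (E : Finset ι) (a b : V) (f g : Set V → ℝ)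
    (hf : Monotone f) (hf0 : f ∅ = 0) (hg : Monotone g) (ψ : Finset ι → Finset ι)
    (hψE : ∀ ω, ω ⊆ E → b ∉ openCluster (ends '' (↑ω : Set ι)) a → b ∉ openCluster (ends '' (↑(E \ ω) : Set ι)) a → ψ ω ⊆ E)
    (hψcov : ∀ ω, ω ⊆ E → b ∉ openCluster (ends '' (↑ω : Set ι)) a → b ∉ openCluster (ends '' (↑(E \ ω) : Set ι)) a →
      openCluster (ends '' (↑ω : Set ι)) a ∪ openCluster (ends '' (↑(E \ ω) : Set ι)) b ⊆
        openCluster (ends '' (↑(ψ ω) : Set ι)) a ∪ openCluster (ends '' (↑(ψ ω) : Set ι)) b)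
    (hψinj : ∀ ω₁ ω₂, ω₁ ⊆ E → b ∉ openCluster (ends '' (↑ω₁ : Set ι)) a → b ∉ openCluster (ends '' (↑(E \ ω₁) : Set ι)) a →
      ω₂ ⊆ E → b ∉ openCluster (ends '' (↑ω₂ : Set ι)) a → b ∉ openCluster (ends '' (↑(E \ ω₂) : Set ι)) a → ψ ω₁ = ψ ω₂ → ω₁ = ω₂) :
    0 ≤ (∑ ω ∈ E.powerset,
        f (openCluster (ends '' (↑ω : Set ι)) a ∪ openCluster (ends '' (↑ω : Set ι)) b) *
          (g (openCluster (ends '' (↑ω : Set ι)) a ∪ openCluster (ends '' (↑ω : Set ι)) b) - g ∅))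
      + ∑ ω ∈ E.powerset.filter (fun ω : Finset ι => b ∉ openCluster (ends '' (↑ω : Set ι)) a ∧ b ∉ openCluster (ends '' (↑(E \ ω) : Set ι)) a),
        (f (openCluster (ends '' (↑ω : Set ι)) a) * (g (openCluster (ends '' (↑ω : Set ι)) a) - g (openCluster (ends '' (↑(E \ ω) : Set ι)) b))
          + f (openCluster (ends '' (↑ω : Set ι)) b) * (g (openCluster (ends '' (↑ω : Set ι)) b) - g (openCluster (ends '' (↑(E \ ω) : Set ι)) a))) := by
  -- notation-free abbreviations
  set C : Finset ι → V → Set V := fun ω v => openCluster (ends '' (↑ω : Set ι)) v with hC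
  set P : Finset ι → ℝ := fun ω => f (C ω a ∪ C ω b) with hP
  set Gn : Finset ι → ℝ := fun ω => g (C ω a ∪ C ω b) - g ∅ with hGn
  set D : Finset (Finset ι) := E.powerset.filter (fun ω => b ∉ C ω a ∧ b ∉ C (E \ ω) a) with hD
  change 0 ≤ (∑ ω ∈ E.powerset, P ω * Gn ω) +
    ∑ ω ∈ D, (f (C ω a) * (g (C ω a) - g (C (E \ ω) b)) + f (C ω b) * (g (C ω b) - g (C (E \ ω) a)))
  have hf_nonneg : ∀ S : Set V, 0 ≤ f S := fun S => by rw [← hf0]; exact hf (Set.empty_subset S)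
  have hP0 : ∀ ω, 0 ≤ P ω := fun ω => hf_nonneg _
  have hG0 : ∀ ω, 0 ≤ Gn ω := fun ω => by simp only [hGn]; linarith [hg (Set.empty_subset (C ω a ∪ C ω b))]
  have hDmem : ∀ {ω}, ω ∈ D ↔ ω ⊆ E ∧ b ∉ C ω a ∧ b ∉ C (E \ ω) a := fun {ω} => by
    rw [hD, Finset.mem_filter, Finset.mem_powerset]
  -- (1) symmetrise the second anti term by the colour swap
  have hswap : ∑ ω ∈ D, f (C ω b) * (g (C ω b) - g (C (E \ ω) a)) =
      ∑ ω ∈ D, f (C (E \ ω) b) * (g (C (E \ ω) b) - g (C ω a)) := by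
    have h := sum_powerset_filter_sdiff E (fun ω : Finset ι => b ∉ C ω a ∧ b ∉ C (E \ ω) a)
      (fun s hs => by rw [Finset.sdiff_sdiff_eq_self hs]; exact and_comm)
      (fun ω => f (C ω b) * (g (C ω b) - g (C (E \ ω) a)))
    rw [hD, ← h]
    refine Finset.sum_congr rfl fun ω hω => ?_
    rw [Finset.mem_filter, Finset.mem_powerset] at hω
    rw [Finset.sdiff_sdiff_eq_self hω.1]
  -- (2) the Harris sum dominates its restriction to the image of the wall event under `ψ`
  have himg : ∑ ω ∈ D, P (ψ ω) * Gn (ψ ω) ≤ ∑ ω ∈ E.powerset, P ω * Gn ω := by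
    have hinj : ∀ ω₁ ∈ D, ∀ ω₂ ∈ D, ψ ω₁ = ψ ω₂ → ω₁ = ω₂ := by
      intro ω₁ h₁ ω₂ h₂ h
      obtain ⟨s1, r1, b1⟩ := hDmem.mp h₁
      obtain ⟨s2, r2, b2⟩ := hDmem.mp h₂
      exact hψinj ω₁ ω₂ s1 r1 b1 s2 r2 b2 h
    have e : ∑ ω ∈ D, P (ψ ω) * Gn (ψ ω) = ∑ ω' ∈ D.image ψ, P ω' * Gn ω' :=
      (Finset.sum_image (f := fun ω' => P ω' * Gn ω') hinj).symm
    rw [e]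
    refine Finset.sum_le_sum_of_subset_of_nonneg ?_ (fun ω _ _ => mul_nonneg (hP0 ω) (hG0 ω))
    intro ω' hω'
    rw [Finset.mem_image] at hω'
    obtain ⟨ω, hω, rfl⟩ := hω'
    obtain ⟨s1, r1, b1⟩ := hDmem.mp hω
    exact Finset.mem_powerset.mpr (hψE ω s1 r1 b1)
  -- (3) pointwise: Harris term at `ψ ω` plus the symmetrised kernel term at `ω` is nonnegative
  have hpt : ∀ ω ∈ D, 0 ≤ P (ψ ω) * Gn (ψ ω) +
      (f (C ω a) * (g (C ω a) - g (C (E \ ω) b)) + f (C (E \ ω) b) * (g (C (E \ ω) b) - g (C ω a))) := by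
    intro ω hω
    obtain ⟨s1, r1, b1⟩ := hDmem.mp hω
    have hcov : C ω a ∪ C (E \ ω) b ⊆ C (ψ ω) a ∪ C (ψ ω) b := hψcov ω s1 r1 b1
    have hPa : C ω a ⊆ C (ψ ω) a ∪ C (ψ ω) b := fun y hy => hcov (Set.mem_union_left _ hy)
    have hQb : C (E \ ω) b ⊆ C (ψ ω) a ∪ C (ψ ω) b := fun y hy => hcov (Set.mem_union_right _ hy)
    have e : f (C ω a) * (g (C ω a) - g (C (E \ ω) b)) + f (C (E \ ω) b) * (g (C (E \ ω) b) - g (C ω a)) =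
        (f (C ω a) - f (C (E \ ω) b)) * ((g (C ω a) - g ∅) - (g (C (E \ ω) b) - g ∅)) := by ring
    rw [e]
    exact mul_add_sub_mul_sub_nonneg (hf_nonneg _) (hf hPa) (hf_nonneg _) (hf hQb)
      (by linarith [hg (Set.empty_subset (C ω a))]) (by simp only [hGn]; linarith [hg hPa])
      (by linarith [hg (Set.empty_subset (C (E \ ω) b))]) (by simp only [hGn]; linarith [hg hQb])
  -- (4) assemble
  have hsum : 0 ≤ ∑ ω ∈ D, (P (ψ ω) * Gn (ψ ω) +
      (f (C ω a) * (g (C ω a) - g (C (E \ ω) b)) + f (C (E \ ω) b) * (g (C (E \ ω) b) - g (C ω a)))) :=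
    Finset.sum_nonneg hpt
  rw [Finset.sum_add_distrib] at hsum
  rw [Finset.sum_add_distrib, hswap, ← Finset.sum_add_distrib]
  linarith

open Classical in
/-- **THEOREM KB-DOM — CW-PA for the core class `N(x) = N(z) = {a, b}` from a domination map of the middle graph.**  Let the multigraph `ends` have
edge set `E₀ = E_H ∪ {ixa, ixb, iza, izb}` (`ends ixa = s(x,a)`, `ixb = s(x,b)`, `iza = s(z,a)`, `izb = s(z,b)`; no edge of `E_H` at `x` or `z`;
`x, z, a, b` as distinct as needed), and suppose the middle graph admits a domination map `ψ`: `ψ ω ⊆ E_H`, injective on the wall event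
`{b ∉ C_a(ω), b ∉ C_a(E_H ∖ ω)}`, with `C_a(ω) ∪ C_b(E_H ∖ ω) ⊆ C_a(ψ ω) ∪ C_b(ψ ω)` there.  Then for ALL monotone `f, g`,
`0 ≤ Σ_{s ⊆ E₀ : z ∉ C_x(s), z ∉ C_x(E₀∖s)} f(C_x s)·(g(C_x s) − g(C_x(E₀∖s)))`.
[cite: KozmaNitzan2024, Questions 8–9 (§5.5 p. 36) (context)] -/
theorem cwpa_coreClass_of_dom (ends : ι → Sym2 V) (EH E₀ : Finset ι) (x z a b : V) (ixa ixb iza izb : ι)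
    (hxa : ends ixa = s(x, a)) (hxb : ends ixb = s(x, b)) (hza : ends iza = s(z, a)) (hzb : ends izb = s(z, b))
    (hH : ∀ i ∈ EH, x ∉ ends i ∧ z ∉ ends i) (hE₀ : ∀ i, i ∈ E₀ ↔ i ∈ EH ∨ i = ixa ∨ i = ixb ∨ i = iza ∨ i = izb)
    (hnot : ixa ∉ EH ∧ ixb ∉ EH ∧ iza ∉ EH ∧ izb ∉ EH)
    (hd : ixa ≠ ixb ∧ ixa ≠ iza ∧ ixa ≠ izb ∧ ixb ≠ iza ∧ ixb ≠ izb ∧ iza ≠ izb)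
    (hxz : x ≠ z) (hxa' : x ≠ a) (hxb' : x ≠ b) (hza' : z ≠ a) (hzb' : z ≠ b)
    (ψ : Finset ι → Finset ι)
    (hψE : ∀ ω, ω ⊆ EH → b ∉ openCluster (ends '' (↑ω : Set ι)) a → b ∉ openCluster (ends '' (↑(EH \ ω) : Set ι)) a → ψ ω ⊆ EH)
    (hψcov : ∀ ω, ω ⊆ EH → b ∉ openCluster (ends '' (↑ω : Set ι)) a → b ∉ openCluster (ends '' (↑(EH \ ω) : Set ι)) a →
      openCluster (ends '' (↑ω : Set ι)) a ∪ openCluster (ends '' (↑(EH \ ω) : Set ι)) b ⊆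
        openCluster (ends '' (↑(ψ ω) : Set ι)) a ∪ openCluster (ends '' (↑(ψ ω) : Set ι)) b)
    (hψinj : ∀ ω₁ ω₂, ω₁ ⊆ EH → b ∉ openCluster (ends '' (↑ω₁ : Set ι)) a → b ∉ openCluster (ends '' (↑(EH \ ω₁) : Set ι)) a →
      ω₂ ⊆ EH → b ∉ openCluster (ends '' (↑ω₂ : Set ι)) a → b ∉ openCluster (ends '' (↑(EH \ ω₂) : Set ι)) a → ψ ω₁ = ψ ω₂ → ω₁ = ω₂)
    (f g : Set V → ℝ) (hf : Monotone f) (hg : Monotone g) :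
    0 ≤ ∑ s ∈ E₀.powerset.filter (fun s : Finset ι => z ∉ openCluster (ends '' (↑s : Set ι)) x ∧ z ∉ openCluster (ends '' (↑(E₀ \ s) : Set ι)) x),
      f (openCluster (ends '' (↑s : Set ι)) x) * (g (openCluster (ends '' (↑s : Set ι)) x) - g (openCluster (ends '' (↑(E₀ \ s) : Set ι)) x)) := by
  set K : Finset ι → Set V := fun s => openCluster (ends '' (↑s : Set ι)) x with hK
  set Tset := E₀.powerset.filter (fun s : Finset ι => z ∉ K s ∧ z ∉ K (E₀ \ s)) with hT
  change 0 ≤ ∑ s ∈ Tset, f (K s) * (g (K s) - g (K (E₀ \ s)))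
  -- normalise `f` at `{x}`
  set c : ℝ := f {x} with hc
  obtain ⟨f', hf'⟩ : ∃ f' : Set V → ℝ, f' = fun S => f S - c := ⟨_, rfl⟩
  have hswap0 : ∑ s ∈ Tset, (g (K s) - g (K (E₀ \ s))) = 0 := by
    rw [Finset.sum_sub_distrib, sub_eq_zero]
    have h := sum_powerset_filter_sdiff E₀ (fun s : Finset ι => z ∉ K s ∧ z ∉ K (E₀ \ s))
      (fun s hs => by rw [Finset.sdiff_sdiff_eq_self hs]; exact and_comm) (fun s => g (K s))
    rw [hT]
    exact h.symm
  have hnorm : ∑ s ∈ Tset, f (K s) * (g (K s) - g (K (E₀ \ s))) = ∑ s ∈ Tset, f' (K s) * (g (K s) - g (K (E₀ \ s))) := by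
    have : ∑ s ∈ Tset, f (K s) * (g (K s) - g (K (E₀ \ s))) =
        ∑ s ∈ Tset, f' (K s) * (g (K s) - g (K (E₀ \ s))) + c * ∑ s ∈ Tset, (g (K s) - g (K (E₀ \ s))) := by
      rw [Finset.mul_sum, ← Finset.sum_add_distrib]
      refine Finset.sum_congr rfl fun s _ => ?_
      simp only [hf']; ring
    rw [this, hswap0, mul_zero, add_zero]
  rw [hnorm]
  -- split by the colours of `xa`, `xb`
  set F : Finset ι → ℝ := fun s => f' (K s) * (g (K s) - g (K (E₀ \ s))) with hF
  have hsplit : ∀ s, F s = (if ixa ∈ s ∧ ixb ∈ s then F s else 0) + (if ixa ∈ s ∧ ixb ∉ s then F s else 0)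
      + (if ixb ∈ s ∧ ixa ∉ s then F s else 0) + (if ixa ∉ s ∧ ixb ∉ s then F s else 0) := by
    intro s; by_cases h1 : ixa ∈ s <;> by_cases h2 : ixb ∈ s <;> simp [h1, h2]
  have hparts : ∑ s ∈ Tset, F s =
      (∑ s ∈ Tset.filter (fun s => ixa ∈ s ∧ ixb ∈ s), F s) + (∑ s ∈ Tset.filter (fun s => ixa ∈ s ∧ ixb ∉ s), F s)
      + (∑ s ∈ Tset.filter (fun s => ixb ∈ s ∧ ixa ∉ s), F s) + (∑ s ∈ Tset.filter (fun s => ixa ∉ s ∧ ixb ∉ s), F s) := by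
    have h0 : ∑ s ∈ Tset, F s = ∑ s ∈ Tset, ((if ixa ∈ s ∧ ixb ∈ s then F s else 0) + (if ixa ∈ s ∧ ixb ∉ s then F s else 0)
        + (if ixb ∈ s ∧ ixa ∉ s then F s else 0) + (if ixa ∉ s ∧ ixb ∉ s then F s else 0)) :=
      Finset.sum_congr rfl (fun s _ => hsplit s)
    rw [h0, Finset.sum_add_distrib, Finset.sum_add_distrib, Finset.sum_add_distrib, ← Finset.sum_filter, ← Finset.sum_filter,
      ← Finset.sum_filter, ← Finset.sum_filter]
  change 0 ≤ ∑ s ∈ Tset, F s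
  rw [hparts]
  -- the four index sets as filters of `E₀.powerset`
  have hsetEq : ∀ (p : Finset ι → Prop) [DecidablePred p],
      Tset.filter p = E₀.powerset.filter (fun s : Finset ι => (z ∉ K s ∧ z ∉ K (E₀ \ s)) ∧ p s) := by
    intro p _; ext s; simp only [hT, Finset.mem_filter, and_assoc]
  -- part RR
  have hRR : ∑ s ∈ Tset.filter (fun s => ixa ∈ s ∧ ixb ∈ s), F s =
      ∑ ω ∈ EH.powerset, f' ({x} ∪ openCluster (ends '' (↑ω : Set ι)) a ∪ openCluster (ends '' (↑ω : Set ι)) b) *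
        (g ({x} ∪ openCluster (ends '' (↑ω : Set ι)) a ∪ openCluster (ends '' (↑ω : Set ι)) b) - g {x}) := by
    have h := coreClass_sum_two ends EH E₀ hxa hxb hza hzb hH hE₀ hnot hd hxz hxa' hxb' hza' hzb' (fun P Q => f' P * (g P - g Q))
    beta_reduce at h
    rw [← h]
    exact Finset.sum_congr (hsetEq _) (fun s _ => rfl)
  -- part RB
  have hRB : ∑ s ∈ Tset.filter (fun s => ixa ∈ s ∧ ixb ∉ s), F s =
      ∑ ω ∈ EH.powerset.filter (fun ω : Finset ι => b ∉ openCluster (ends '' (↑ω : Set ι)) a ∧ b ∉ openCluster (ends '' (↑(EH \ ω) : Set ι)) a),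
        f' ({x} ∪ openCluster (ends '' (↑ω : Set ι)) a) * (g ({x} ∪ openCluster (ends '' (↑ω : Set ι)) a) - g ({x} ∪ openCluster (ends '' (↑(EH \ ω) : Set ι)) b)) := by
    have h := coreClass_sum_one ends EH E₀ hxa hxb hza hzb hH hE₀ hnot hd hxz hxa' hxb' hza' hzb' (fun P Q => f' P * (g P - g Q))
    beta_reduce at h
    rw [← h]
    exact Finset.sum_congr (hsetEq _) (fun s _ => rfl)
  -- part BR: the same lemma with `a ↔ b`
  have hBR : ∑ s ∈ Tset.filter (fun s => ixb ∈ s ∧ ixa ∉ s), F s =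
      ∑ ω ∈ EH.powerset.filter (fun ω : Finset ι => b ∉ openCluster (ends '' (↑ω : Set ι)) a ∧ b ∉ openCluster (ends '' (↑(EH \ ω) : Set ι)) a),
        f' ({x} ∪ openCluster (ends '' (↑ω : Set ι)) b) * (g ({x} ∪ openCluster (ends '' (↑ω : Set ι)) b) - g ({x} ∪ openCluster (ends '' (↑(EH \ ω) : Set ι)) a)) := by
    have hE₀' : ∀ i, i ∈ E₀ ↔ i ∈ EH ∨ i = ixb ∨ i = ixa ∨ i = izb ∨ i = iza := fun i => by rw [hE₀ i]; tauto
    have h := coreClass_sum_one ends EH E₀ (x := x) (z := z) (a := b) (b := a) hxb hxa hzb hza hH hE₀'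
      ⟨hnot.2.1, hnot.1, hnot.2.2.2, hnot.2.2.1⟩ ⟨hd.1.symm, hd.2.2.2.2.1, hd.2.2.2.1, hd.2.2.1, hd.2.1, hd.2.2.2.2.2.symm⟩
      hxz hxb' hxa' hzb' hza' (fun P Q => f' P * (g P - g Q))
    beta_reduce at h
    have hidx : EH.powerset.filter (fun ω : Finset ι => a ∉ openCluster (ends '' (↑ω : Set ι)) b ∧ a ∉ openCluster (ends '' (↑(EH \ ω) : Set ι)) b) =
        EH.powerset.filter (fun ω : Finset ι => b ∉ openCluster (ends '' (↑ω : Set ι)) a ∧ b ∉ openCluster (ends '' (↑(EH \ ω) : Set ι)) a) := by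
      ext ω; simp only [Finset.mem_filter, mem_openCluster_comm ends ω b a, mem_openCluster_comm ends (EH \ ω) b a]
    rw [← hidx, ← h]
    exact Finset.sum_congr (hsetEq _) (fun s _ => rfl)
  -- part BB vanishes
  have hBB : ∑ s ∈ Tset.filter (fun s => ixa ∉ s ∧ ixb ∉ s), F s = 0 := by
    refine Finset.sum_eq_zero fun s hs => ?_
    rw [Finset.mem_filter, hT, Finset.mem_filter, Finset.mem_powerset] at hs
    obtain ⟨⟨hsE, -⟩, h1, h2⟩ := hs
    have hKs : K s = {x} := by
      refine openCluster_eq_singleton_of_no_edge_at ends s (fun i hi => ?_)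
      rcases (hE₀ i).mp (hsE hi) with h | rfl | rfl | rfl | rfl
      · exact (hH i h).1
      · exact absurd hi h1
      · exact absurd hi h2
      · rw [hza, Sym2.mem_iff, not_or]; exact ⟨hxz, hxa'⟩
      · rw [hzb, Sym2.mem_iff, not_or]; exact ⟨hxz, hxb'⟩
    simp only [hF, hf', hKs, hc, sub_self, zero_mul]
  rw [hRR, hRB, hBR, hBB, add_zero]
  -- the kernel, from the domination map
  have hker := coreClass_kernel_nonneg_of_dom ends EH a b (fun S => f ({x} ∪ S) - c) (fun S => g ({x} ∪ S))
    (fun P Q h => by linarith [hf (Set.union_subset_union_right {x} h)])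
    (by simp only [Set.union_empty, hc, sub_self])
    (fun P Q h => hg (Set.union_subset_union_right {x} h)) ψ hψE hψcov hψinj
  simp only [Set.union_empty] at hker
  rw [Finset.sum_add_distrib] at hker
  simp only [hf', Set.union_assoc]
  linarith

open Classical in
/-- **THEOREM KB-DOM, symmetric form.**  Under the hypotheses of `cwpa_coreClass_of_dom` (core class `N(x) = N(z) = {a,b}`, middle graph with a
domination map), for all monotone `f, g`:
`0 ≤ Σ_{s ⊆ E₀ : z ∉ C_x(s), z ∉ C_x(E₀∖s)} (f(C_x s) − f(C_x(E₀∖s)))·(g(C_x s) − g(C_x(E₀∖s)))` — the form `(E₀; x, z) ∈ 𝒞` consumed by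
prim-lf-2's closure theorems (`cwpa_decoration`, `cwpa_series`, `cwpa_parallel`).  [cite: KozmaNitzan2024, Questions 8–9 (§5.5 p. 36) (context)] -/
theorem cwpa_coreClass_symm_of_dom (ends : ι → Sym2 V) (EH E₀ : Finset ι) (x z a b : V) (ixa ixb iza izb : ι)
    (hxa : ends ixa = s(x, a)) (hxb : ends ixb = s(x, b)) (hza : ends iza = s(z, a)) (hzb : ends izb = s(z, b))
    (hH : ∀ i ∈ EH, x ∉ ends i ∧ z ∉ ends i) (hE₀ : ∀ i, i ∈ E₀ ↔ i ∈ EH ∨ i = ixa ∨ i = ixb ∨ i = iza ∨ i = izb)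
    (hnot : ixa ∉ EH ∧ ixb ∉ EH ∧ iza ∉ EH ∧ izb ∉ EH)
    (hd : ixa ≠ ixb ∧ ixa ≠ iza ∧ ixa ≠ izb ∧ ixb ≠ iza ∧ ixb ≠ izb ∧ iza ≠ izb)
    (hxz : x ≠ z) (hxa' : x ≠ a) (hxb' : x ≠ b) (hza' : z ≠ a) (hzb' : z ≠ b)
    (ψ : Finset ι → Finset ι)
    (hψE : ∀ ω, ω ⊆ EH → b ∉ openCluster (ends '' (↑ω : Set ι)) a → b ∉ openCluster (ends '' (↑(EH \ ω) : Set ι)) a → ψ ω ⊆ EH)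
    (hψcov : ∀ ω, ω ⊆ EH → b ∉ openCluster (ends '' (↑ω : Set ι)) a → b ∉ openCluster (ends '' (↑(EH \ ω) : Set ι)) a →
      openCluster (ends '' (↑ω : Set ι)) a ∪ openCluster (ends '' (↑(EH \ ω) : Set ι)) b ⊆
        openCluster (ends '' (↑(ψ ω) : Set ι)) a ∪ openCluster (ends '' (↑(ψ ω) : Set ι)) b)
    (hψinj : ∀ ω₁ ω₂, ω₁ ⊆ EH → b ∉ openCluster (ends '' (↑ω₁ : Set ι)) a → b ∉ openCluster (ends '' (↑(EH \ ω₁) : Set ι)) a →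
      ω₂ ⊆ EH → b ∉ openCluster (ends '' (↑ω₂ : Set ι)) a → b ∉ openCluster (ends '' (↑(EH \ ω₂) : Set ι)) a → ψ ω₁ = ψ ω₂ → ω₁ = ω₂)
    (f g : Set V → ℝ) (hf : Monotone f) (hg : Monotone g) :
    0 ≤ ∑ s ∈ E₀.powerset.filter (fun s : Finset ι => z ∉ openCluster (ends '' (↑s : Set ι)) x ∧ z ∉ openCluster (ends '' (↑(E₀ \ s) : Set ι)) x),
      (f (openCluster (ends '' (↑s : Set ι)) x) - f (openCluster (ends '' (↑(E₀ \ s) : Set ι)) x)) *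
        (g (openCluster (ends '' (↑s : Set ι)) x) - g (openCluster (ends '' (↑(E₀ \ s) : Set ι)) x)) := by
  set K : Finset ι → Set V := fun s => openCluster (ends '' (↑s : Set ι)) x with hK
  set Tset := E₀.powerset.filter (fun s : Finset ι => z ∉ K s ∧ z ∉ K (E₀ \ s)) with hT
  change 0 ≤ ∑ s ∈ Tset, (f (K s) - f (K (E₀ \ s))) * (g (K s) - g (K (E₀ \ s)))
  have h1 := cwpa_coreClass_of_dom ends EH E₀ x z a b ixa ixb iza izb hxa hxb hza hzb hH hE₀ hnot hd hxz hxa' hxb' hza' hzb'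
    ψ hψE hψcov hψinj f g hf hg
  change 0 ≤ ∑ s ∈ Tset, f (K s) * (g (K s) - g (K (E₀ \ s))) at h1
  have h2 : ∑ s ∈ Tset, f (K (E₀ \ s)) * (g (K (E₀ \ s)) - g (K s)) = ∑ s ∈ Tset, f (K s) * (g (K s) - g (K (E₀ \ s))) := by
    have h := sum_powerset_filter_sdiff E₀ (fun s : Finset ι => z ∉ K s ∧ z ∉ K (E₀ \ s))
      (fun s hs => by rw [Finset.sdiff_sdiff_eq_self hs]; exact and_comm) (fun s => f (K s) * (g (K s) - g (K (E₀ \ s))))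
    rw [hT, ← h]
    refine Finset.sum_congr rfl fun s hs => ?_
    rw [Finset.mem_filter, Finset.mem_powerset] at hs
    rw [Finset.sdiff_sdiff_eq_self hs.1]
  have h3 : ∑ s ∈ Tset, (f (K s) - f (K (E₀ \ s))) * (g (K s) - g (K (E₀ \ s))) =
      ∑ s ∈ Tset, f (K s) * (g (K s) - g (K (E₀ \ s))) + ∑ s ∈ Tset, f (K (E₀ \ s)) * (g (K (E₀ \ s)) - g (K s)) := by
    rw [← Finset.sum_add_distrib]
    refine Finset.sum_congr rfl fun s _ => by ring
  rw [h3, h2]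
  linarith

end Coefficientwise

end Summit.CriticalPhenomena.PercolationContinuityZ3.Theorems
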